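import Summits.BirchSwinnertonDyer.BirchSwinnertonDyer.Theorems.GenusKolyvaginAtTwoPowDvdShaCardAtTwoRTLadderFrame
import HarnessLib

/-!
# Route `GenusKolyvaginAtTwo`, LINE 19 (L⁺_T `PowDvdShaCardAtTwoPosT`, stmt-BirchSwinnertonDyer-23379, `Δ > 0`), stub 3a‴
# `stub_twinLadderGenus` — THE FRAME THEOREM ON `Δ > 0`, modulo the archimedean bit

Seat `bsd-line-gk2-p3` g18 (cell `bsd-f1-sign2`), `--supports stmt-BirchSwinnertonDyer-23379` (helper; closes nothing).
THEOREMS ONLY (no definition, no named fact, no `sorry`); BSD is not proved by any of this.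

LINE 19's 3a‴ reads `2·M₀ ≤ ord₂ g + ord₂ g′ + ord₂ C(Wd)` (genus defect `Σ_{q∣d_K} i_q + [Δ>0] − 1 = ord₂ C(Wd)`).  The abstract
ladder count and the `Ш`-level genus budget of this seat (`…RTLadderCount{,Twin}`, `…RTRelaxedShaGenusBudget`, `…RTLadderFrame{,Bookkeeping}`)
are sign-free except at the real place: on `Δ > 0` the classes over `ℚ` are also RELAXED AT `∞` (`H¹(ℝ, E) ≅ ℤ/2`), and the budget
`relIndex_sha_relaxed_le_prod_natCard_twoTorsion` bounds only the part satisfying the real condition.  This file isolates the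
archimedean cost as ONE explicit hypothesis per side —

  `harch : (res⁻¹(Ш(X_K/K)) ⊓ ker(H¹(ℚ,X) → H¹(ℝ,X))).relIndex (res⁻¹(Ш(X_K/K))) ∣ 2`

(the image of `res⁻¹(Ш(X_K/K))` in `H¹(ℝ, X)` has order `≤ 2`; true because `#H¹(ℝ, E)[2] = #E(ℝ)/2E(ℝ) = 2` on `Δ > 0` — local duality /
the tree's archimedean Kummer count at the Selmer level; its torsor-level form is NOT yet in the tree and is the one residual input of
this file) — and proves:
* `relIndex_sha_comap_resBaseChange_le_two_pow_succ_of_arch` (curve side) and `…_twin_…` (twin side): `[res⁻¹(Ш(X_K/K)) : Ш(X/ℚ)] ≤ 2^{ord₂ C(Wd) + 1}`, finite;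
* **`two_mul_le_padicValNat_add_of_shaLadders_pos`**: the two ladders ⇒ `2·M₀ ≤ ord₂ g + ord₂ g′ + 4⌊(ord₂ C(Wd) + 1)/2⌋`;
* **`twinLadderGenusPos_ineq_of_shaLadders_of_padicValNat_eq_zero`**: on `ord₂ C(Wd) = 0` (every prime of `d_K` silent — gk2-p5's
  silent Heegner fields; the pen's instrument rows `(e, Σ i_p, sgn Δ) = (0, 0, +)`) this is EXACTLY LINE 19's 3a‴
  `2·M₀ ≤ ord₂ g + ord₂ g′ + ord₂ C(Wd)`, modulo the ladders and the archimedean bit.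

References: [McCallumLMS1991] §5; [Kramer1981] §2 Prop. 3, Thm. 1; [GrossLMS1991] §6; [SerreGaloisCohomology1997] I.§2.4.
-/

set_option autoImplicit false
-- the Theorems namespace of this sub repeats the summit name by design (D-0017 nested layout)
set_option linter.dupNamespace false

noncomputable section

open scoped Classical

namespace Summit.BirchSwinnertonDyer.BirchSwinnertonDyer.Theorems.GenusExact.RegularPlusDescent

open WeierstrassCurve NumberField IsDedekindDomain Rat.HeightOneSpectrum Literature.NumberTheory.EllipticCurves
  Literature.Barriers.BirchSwinnertonDyer
open Summit.BirchSwinnertonDyer.BirchSwinnertonDyer.Theorems.GenusExact.PlusDescent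

/-! ## §1 The `Ш`-level budgets with the archimedean bit as a hypothesis -/

section Budget

variable (W : WeierstrassCurve ℚ) [W.IsElliptic] [W.IsGloballyMinimal] (K : Type) [Field K] [NumberField K]
  {Wd : WeierstrassCurve ℚ} [Wd.IsElliptic]

omit [W.IsGloballyMinimal] in
/-- **Sign-free budget with the archimedean bit factored out**: for `X/ℚ` elliptic, `[K:ℚ] = 2`, `d_K` odd, good reduction at the
non-split `p ∤ d_K`, and `[res⁻¹Ш(X_K) : res⁻¹Ш(X_K) ⊓ ker_ℝ] ∣ 2`: `[res⁻¹(Ш(X_K/K)) : Ш(X/ℚ)] ≤ 2 · ∏_{p∣d_K} #X(ℚ_p)[2]`, finite.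
[cite: Kramer1981, §2 Prop. 3 and Thm. 1] [cite: Matsuno2009, Prop. 3.2] -/
theorem relIndex_sha_comap_resBaseChange_le_of_arch (X : WeierstrassCurve ℚ) [X.IsElliptic] (h2 : Module.finrank ℚ K = 2)
    (hodd : Odd (NumberField.discr K))
    (hgood : ∀ p : ℕ, p.Prime → ¬ (p : ℤ) ∣ NumberField.discr K →
      ((Ideal.span {(p : ℤ)}).primesOver (𝓞 K)).ncard ≠ 2 → X.HasGoodReductionAt (Matsuno2009.primePlace p))
    (harch : ((((X.baseChange K).sha).comap (resBaseChange X K)) ⊓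
        ⨅ w : InfinitePlace ℚ, X.localRestrictionKer w.Completion).relIndex
        (((X.baseChange K).sha).comap (resBaseChange X K)) ∣ 2) :
    (X.sha).relIndex (((X.baseChange K).sha).comap (resBaseChange X K)) ≠ 0 ∧
      (X.sha).relIndex (((X.baseChange K).sha).comap (resBaseChange X K)) ≤
        2 * ∏ p ∈ (NumberField.discr K).natAbs.primeFactors,
          Nat.card {P : (X.baseChange ((Matsuno2009.primePlace p).adicCompletion ℚ)).toAffine.Point // 2 • P = 0} := by
  set R : AddSubgroup X.galH1 := ((X.baseChange K).sha).comap (resBaseChange X K) with hR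
  set A : AddSubgroup X.galH1 := ⨅ w : InfinitePlace ℚ, X.localRestrictionKer w.Completion with hA
  have h1 : X.sha ≤ R ⊓ A := sha_le_comap_resBaseChange_sha_inf X K
  have h2' : R ⊓ A ≤ R := inf_le_left
  have hmul := AddSubgroup.relIndex_mul_relIndex (X.sha) (R ⊓ A) R h1 h2'
  have hne := relIndex_sha_relaxed_ne_zero X K h2 hodd hgood
  have hle := relIndex_sha_relaxed_le_prod_natCard_twoTorsion X K h2 hodd hgood
  have harch0 : (R ⊓ A).relIndex R ≠ 0 := fun h ↦ by
    rw [h] at harch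
    exact absurd (Nat.eq_zero_of_zero_dvd harch) two_ne_zero
  have harch2 : (R ⊓ A).relIndex R ≤ 2 := Nat.le_of_dvd two_pos harch
  refine ⟨?_, ?_⟩
  · rw [← hmul]; exact mul_ne_zero hne harch0
  · rw [← hmul, mul_comm 2]
    exact Nat.mul_le_mul hle harch2

/-- **Curve side, LINE 19 frame**: `W` globally minimal with `C(W)` odd, `K` imaginary quadratic with odd `d_K` and Heegner for `N_W`,
`Wd = Cd • W^{(d_K)}` any model, and the archimedian bit for `W`: `[res⁻¹(Ш(W_K/K)) : Ш(W/ℚ)] ≤ 2^{ord₂ C(Wd) + 1}`, finite.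
[cite: Kramer1981, §2 Prop. 3 and Thm. 1] -/
theorem relIndex_sha_comap_resBaseChange_le_two_pow_succ_of_arch (hIQ : IsImaginaryQuadratic K)
    (hodd : Odd (NumberField.discr K)) (hHe : SatisfiesHeegnerHypothesis (W.conductorNorm ℤ) K) (hT : Odd W.tamagawaProduct)
    (Cd : VariableChange ℚ) (hWd : Cd • W.quadraticTwist (NumberField.discr K : ℚ) = Wd)
    (harch : ((((W.baseChange K).sha).comap (resBaseChange W K)) ⊓
        ⨅ w : InfinitePlace ℚ, W.localRestrictionKer w.Completion).relIndex
        (((W.baseChange K).sha).comap (resBaseChange W K)) ∣ 2) :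
    (W.sha).relIndex (((W.baseChange K).sha).comap (resBaseChange W K)) ≠ 0 ∧
      (W.sha).relIndex (((W.baseChange K).sha).comap (resBaseChange W K)) ≤ 2 ^ (padicValNat 2 Wd.tamagawaProduct + 1) := by
  obtain ⟨hne, hle⟩ := relIndex_sha_comap_resBaseChange_le_of_arch K W hIQ.1 hodd
    (fun _ hp _ hns ↦ hasGoodReductionAt_primePlace_of_ncard_ne_two W K hHe hp hns) harch
  refine ⟨hne, hle.trans_eq ?_⟩
  rw [pow_succ, mul_comm (2 ^ _), ← prod_ncard_roots_add_one_eq_two_pow_padicValNat_tamagawaProduct_twin W hIQ hodd hHe hT Cd hWd]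
  congr 1
  refine Finset.prod_congr rfl fun p hp ↦ ?_
  have hD0 : (NumberField.discr K).natAbs ≠ 0 := Int.natAbs_ne_zero.mpr (NumberField.discr_ne_zero K)
  obtain ⟨hpr, hpdvd, -⟩ := Nat.mem_primeFactors.mp hp
  have hpd : (p : ℤ) ∣ NumberField.discr K := Int.natCast_dvd.mpr hpdvd
  have hp2 : p ≠ 2 := by
    rintro rfl
    obtain ⟨r, hr⟩ := hodd
    omega
  haveI := Fact.mk hpr
  rw [natCard_twoTorsion_adicCompletion_eq_padic W (Matsuno2009.primePlace p) (Matsuno2009.natCast_mem_primePlace hpr)]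
  exact GenusKolyTwin.natCard_twoTorsion_padic_eq W hp2
    (not_dvd_minimalDiscriminantInt_of_dvd_discr_of_heegner W K hIQ.1 hHe hpr hp2 hpd)

/-- **Twin side, LINE 19 frame** (same data, archimedean bit for `Wd`): `[res⁻¹(Ш(Wd_K/K)) : Ш(Wd/ℚ)] ≤ 2^{ord₂ C(Wd) + 1}`, finite.
[cite: Kramer1981, §2 Prop. 3 and Thm. 1] -/
theorem relIndex_sha_comap_resBaseChange_twin_le_two_pow_succ_of_arch (hIQ : IsImaginaryQuadratic K)
    (hodd : Odd (NumberField.discr K)) (hHe : SatisfiesHeegnerHypothesis (W.conductorNorm ℤ) K) (hT : Odd W.tamagawaProduct)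
    (Cd : VariableChange ℚ) (hWd : Cd • W.quadraticTwist (NumberField.discr K : ℚ) = Wd)
    (harch : ((((Wd.baseChange K).sha).comap (resBaseChange Wd K)) ⊓
        ⨅ w : InfinitePlace ℚ, Wd.localRestrictionKer w.Completion).relIndex
        (((Wd.baseChange K).sha).comap (resBaseChange Wd K)) ∣ 2) :
    (Wd.sha).relIndex (((Wd.baseChange K).sha).comap (resBaseChange Wd K)) ≠ 0 ∧
      (Wd.sha).relIndex (((Wd.baseChange K).sha).comap (resBaseChange Wd K)) ≤ 2 ^ (padicValNat 2 Wd.tamagawaProduct + 1) := by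
  obtain ⟨hne, hle⟩ := relIndex_sha_comap_resBaseChange_le_of_arch K Wd hIQ.1 hodd
    (fun _ hp hpd hns ↦ hasGoodReductionAt_primePlace_twin_of_ncard_ne_two W K hIQ.1 hodd hHe Cd hWd hp hpd hns) harch
  refine ⟨hne, hle.trans_eq ?_⟩
  rw [pow_succ, mul_comm (2 ^ _), prod_natCard_twoTorsion_twin_eq_two_pow W hIQ hodd hHe hT Cd hWd]

end Budget

/-! ## §2 The frame theorem on `Δ > 0` -/

section Frame

variable (W : WeierstrassCurve ℚ) [W.IsElliptic] [W.IsGloballyMinimal] (K : Type) [Field K] [NumberField K]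
  {Wd : WeierstrassCurve ℚ} [Wd.IsElliptic]

/-- **THE FRAME THEOREM FOR LINE 19's 3a‴ (any sign of `Δ`, archimedean bits as hypotheses).**  `W/ℚ` globally minimal elliptic
with `C(W)` odd; `K` imaginary quadratic, `d_K` odd, Heegner for `N_W`; `Wd = Cd • W^{(d_K)}` elliptic; `Ш(W/ℚ)[2^∞]`, `Ш(Wd/ℚ)[2^∞]`
finite; the archimedean bits `harch`, `harch'`; an antitone ladder `M` with `M_{2T} = 0`; and for every `m < T` independent families
of `2m+2` classes in `H¹(ℚ, W)` (order `2^{M_{2m}−M_{2m+1}}`, restricting into `Ш(W_K/K)`) and in `H¹(ℚ, Wd)` (order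
`2^{M_{2m+1}−M_{2m+2}}`, into `Ш(Wd_K/K)`).  Then `2·M₀ ≤ ord₂ g + ord₂ g′ + 4⌊(ord₂ C(Wd) + 1)/2⌋`.
[cite: McCallumLMS1991, §5 Prop. 5.2, Thm. 5.4, Cor. 5.6] [cite: Kramer1981, §2 Prop. 3 and Thm. 1] -/
theorem two_mul_le_padicValNat_add_of_shaLadders_of_arch (hT : Odd W.tamagawaProduct)
    (hIQ : IsImaginaryQuadratic K) (hodd : Odd (NumberField.discr K)) (hHe : SatisfiesHeegnerHypothesis (W.conductorNorm ℤ) K)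
    (Cd : VariableChange ℚ) (hWd : Cd • W.quadraticTwist (NumberField.discr K : ℚ) = Wd)
    (harch : ((((W.baseChange K).sha).comap (resBaseChange W K)) ⊓
        ⨅ w : InfinitePlace ℚ, W.localRestrictionKer w.Completion).relIndex
        (((W.baseChange K).sha).comap (resBaseChange W K)) ∣ 2)
    (harch' : ((((Wd.baseChange K).sha).comap (resBaseChange Wd K)) ⊓
        ⨅ w : InfinitePlace ℚ, Wd.localRestrictionKer w.Completion).relIndex
        (((Wd.baseChange K).sha).comap (resBaseChange Wd K)) ∣ 2)
    (hg : 0 < Nat.card (AddCommGroup.primaryComponent W.sha 2)) (hg' : 0 < Nat.card (AddCommGroup.primaryComponent Wd.sha 2))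
    (T : ℕ) (M : ℕ → ℕ) (hM : ∀ j, M (j + 1) ≤ M j) (hMT : M (2 * T) = 0)
    (hfam : ∀ m < T, ∃ x : Fin (2 * m + 2) → W.galH1, (∀ i, resBaseChange W K (x i) ∈ (W.baseChange K).sha) ∧
      (∀ i, addOrderOf (x i) = 2 ^ (M (2 * m) - M (2 * m + 1))) ∧
      ∀ c : Fin (2 * m + 2) → ℤ, ∑ i, c i • x i = 0 → ∀ i, ((2 ^ (M (2 * m) - M (2 * m + 1)) : ℕ) : ℤ) ∣ c i)
    (hfam' : ∀ m < T, ∃ x : Fin (2 * m + 2) → Wd.galH1, (∀ i, resBaseChange Wd K (x i) ∈ (Wd.baseChange K).sha) ∧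
      (∀ i, addOrderOf (x i) = 2 ^ (M (2 * m + 1) - M (2 * m + 2))) ∧
      ∀ c : Fin (2 * m + 2) → ℤ, ∑ i, c i • x i = 0 → ∀ i, ((2 ^ (M (2 * m + 1) - M (2 * m + 2)) : ℕ) : ℤ) ∣ c i) :
    2 * M 0 ≤ padicValNat 2 (Nat.card (AddCommGroup.primaryComponent W.sha 2)) +
      padicValNat 2 (Nat.card (AddCommGroup.primaryComponent Wd.sha 2)) +
      2 * ((padicValNat 2 Wd.tamagawaProduct + 1) / 2) + 2 * ((padicValNat 2 Wd.tamagawaProduct + 1) / 2) := by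
  obtain ⟨hne₁, hle₁⟩ := relIndex_sha_comap_resBaseChange_le_two_pow_succ_of_arch W K hIQ hodd hHe hT Cd hWd harch
  obtain ⟨hne₂, hle₂⟩ := relIndex_sha_comap_resBaseChange_twin_le_two_pow_succ_of_arch W K hIQ hodd hHe hT Cd hWd harch'
  have h₁ := two_mul_sum_le_padicValNat_of_shaLadder K W T (fun m ↦ M (2 * m) - M (2 * m + 1)) hg hne₁ hle₁ hfam
  have h₂ := two_mul_sum_le_padicValNat_of_shaLadder K Wd T (fun m ↦ M (2 * m + 1) - M (2 * m + 2)) hg' hne₂ hle₂ hfam'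
  have hsum : 2 * ∑ m ∈ Finset.range T, (M (2 * m) - M (2 * m + 1)) +
      2 * ∑ m ∈ Finset.range T, (M (2 * m + 1) - M (2 * m + 2)) =
      2 * ∑ j ∈ Finset.range (2 * T), (M j - M (j + 1)) := by
    rw [sum_range_two_mul (fun j => M j - M (j + 1)), ← mul_add, ← Finset.sum_add_distrib]
  rw [sum_range_sub_eq_of_antitone M hM, hMT, Nat.sub_zero] at hsum
  omega

/-- **LINE 19's 3a‴ ON `ord₂ C(Wd) = 0`, MODULO THE LADDERS AND THE ARCHIMEDEAN BIT.**  With `ord₂ C(Wd) = 0` (every prime of `d_K`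
silent: `Ẽ(𝔽_q)[2] = 0`) the frame theorem gives `2·M₀ ≤ ord₂ g + ord₂ g′ + ord₂ C(Wd)` — the conclusion of LINE 19's registered
stub `stub_twinLadderGenus` verbatim (each side loses at most the archimedean bit, refunded by Cassels–Tate parity).
[cite: McCallumLMS1991, §5 Thm. 5.4, Cor. 5.6] [cite: Kramer1981, §2 Prop. 3 and Thm. 1] -/
theorem twinLadderGenusPos_ineq_of_shaLadders_of_padicValNat_eq_zero (hT : Odd W.tamagawaProduct)
    (hIQ : IsImaginaryQuadratic K) (hodd : Odd (NumberField.discr K)) (hHe : SatisfiesHeegnerHypothesis (W.conductorNorm ℤ) K)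
    (Cd : VariableChange ℚ) (hWd : Cd • W.quadraticTwist (NumberField.discr K : ℚ) = Wd)
    (hB : padicValNat 2 Wd.tamagawaProduct = 0)
    (harch : ((((W.baseChange K).sha).comap (resBaseChange W K)) ⊓
        ⨅ w : InfinitePlace ℚ, W.localRestrictionKer w.Completion).relIndex
        (((W.baseChange K).sha).comap (resBaseChange W K)) ∣ 2)
    (harch' : ((((Wd.baseChange K).sha).comap (resBaseChange Wd K)) ⊓
        ⨅ w : InfinitePlace ℚ, Wd.localRestrictionKer w.Completion).relIndex
        (((Wd.baseChange K).sha).comap (resBaseChange Wd K)) ∣ 2)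
    (hg : 0 < Nat.card (AddCommGroup.primaryComponent W.sha 2)) (hg' : 0 < Nat.card (AddCommGroup.primaryComponent Wd.sha 2))
    (T : ℕ) (M : ℕ → ℕ) (hM : ∀ j, M (j + 1) ≤ M j) (hMT : M (2 * T) = 0)
    (hfam : ∀ m < T, ∃ x : Fin (2 * m + 2) → W.galH1, (∀ i, resBaseChange W K (x i) ∈ (W.baseChange K).sha) ∧
      (∀ i, addOrderOf (x i) = 2 ^ (M (2 * m) - M (2 * m + 1))) ∧
      ∀ c : Fin (2 * m + 2) → ℤ, ∑ i, c i • x i = 0 → ∀ i, ((2 ^ (M (2 * m) - M (2 * m + 1)) : ℕ) : ℤ) ∣ c i)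
    (hfam' : ∀ m < T, ∃ x : Fin (2 * m + 2) → Wd.galH1, (∀ i, resBaseChange Wd K (x i) ∈ (Wd.baseChange K).sha) ∧
      (∀ i, addOrderOf (x i) = 2 ^ (M (2 * m + 1) - M (2 * m + 2))) ∧
      ∀ c : Fin (2 * m + 2) → ℤ, ∑ i, c i • x i = 0 → ∀ i, ((2 ^ (M (2 * m + 1) - M (2 * m + 2)) : ℕ) : ℤ) ∣ c i) :
    (2 * M 0 : ℤ) ≤ (padicValNat 2 (Nat.card (AddCommGroup.primaryComponent W.sha 2)) : ℤ) +
      (padicValNat 2 (Nat.card (AddCommGroup.primaryComponent Wd.sha 2)) : ℤ) +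
      (padicValNat 2 Wd.tamagawaProduct : ℤ) := by
  have h := two_mul_le_padicValNat_add_of_shaLadders_of_arch W K hT hIQ hodd hHe Cd hWd harch harch' hg hg' T M hM hMT hfam hfam'
  rw [hB] at h
  set a := padicValNat 2 (Nat.card (AddCommGroup.primaryComponent W.sha 2)) with ha
  set b := padicValNat 2 (Nat.card (AddCommGroup.primaryComponent Wd.sha 2)) with hb
  rw [hB]
  push_cast
  omega

end Frame

end Summit.BirchSwinnertonDyer.BirchSwinnertonDyer.Theorems.GenusExact.RegularPlusDescent

end
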